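import Mathlib
import HarnessLib

/-!
# A closed-form value bound for the weighted far tail

Companion to `SrwISeedTail` / `SrwISeedTailSummable`: if the tail majorant obeys a power law
`B(m) ≤ K m^{-s}` for `m ≥ M ≥ 1` with `s > n + 1`, then the weighted tail series of the seed
enclosure `srwI_succ_mem_Icc` has the explicit VALUE bound
`Σ_j C(2(M+j)+a+n, n) B(M+j) ≤ K (3+n)^n ( M^{-(s-n)} + M^{1-(s-n)}/(s-n-1) )`
(integral comparison for the `p`-series).  With the far-tail law (FT′)
`q_m ≤ K(d,λ,M₀) m^{-d/2}` (`SrwLawFarTailRpow`) this turns the far-tail contribution of the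
SEEDCERT-P enclosure into a closed-form real number; no summability hypothesis is needed
(`Real.tsum_le_of_sum_range_le`). [folklore]
-/

namespace Literature.Probability.FitznerVanDerHofstad2017

open Finset MeasureTheory intervalIntegral

/-- `p`-series tail by integral comparison: for `M ≥ 1`, `r > 1` and every `J`,
`Σ_{j<J} (M+j)^{-r} ≤ M^{-r} + M^{1-r}/(r-1)`. [folklore] -/
theorem sum_range_rpow_neg_le {M : ℕ} (hM : 1 ≤ M) {r : ℝ} (hr : 1 < r) (J : ℕ) :
    ∑ j ∈ range J, ((M + j : ℕ) : ℝ) ^ (-r) ≤ (M : ℝ) ^ (-r) + (M : ℝ) ^ (1 - r) / (r - 1) := by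
  have hM' : (1 : ℝ) ≤ M := by exact_mod_cast hM
  have hM0 : (0 : ℝ) < M := by linarith
  have hr1 : 0 < r - 1 := by linarith
  have hT0 : 0 ≤ (M : ℝ) ^ (1 - r) / (r - 1) := by positivity
  cases J with
  | zero => simp; positivity
  | succ J =>
    rw [Finset.sum_range_succ']
    simp only [add_zero]
    rw [add_comm]
    refine add_le_add le_rfl ?_
    -- the shifted sum is bounded by the integral
    have hanti : AntitoneOn (fun x : ℝ => x ^ (-r)) (Set.Icc (M : ℝ) ((M + J : ℕ) : ℝ)) := by
      intro x hx y hy hxy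
      have hx0 : 0 < x := lt_of_lt_of_le hM0 hx.1
      exact Real.rpow_le_rpow_of_nonpos hx0 hxy (by linarith)
    have hsum := AntitoneOn.sum_le_integral_Ico (f := fun x : ℝ => x ^ (-r))
      (show M ≤ M + J by omega) hanti
    have hre : ∑ j ∈ range J, ((M + (j + 1) : ℕ) : ℝ) ^ (-r)
        = ∑ i ∈ Finset.Ico M (M + J), (((i + 1 : ℕ) : ℝ)) ^ (-r) := by
      rw [Finset.sum_Ico_eq_sum_range]
      simp only [Nat.add_sub_cancel_left]
      refine Finset.sum_congr rfl fun j _ => ?_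
      push_cast; ring_nf
    rw [hre]
    refine hsum.trans ?_
    -- evaluate the integral
    have hint : ∫ x in (M : ℝ)..((M + J : ℕ) : ℝ), x ^ (-r)
        = ((((M + J : ℕ) : ℝ)) ^ (-r + 1) - (M : ℝ) ^ (-r + 1)) / (-r + 1) := by
      apply integral_rpow
      right
      refine ⟨by linarith, ?_⟩
      have hN' : (M : ℝ) ≤ ((M + J : ℕ) : ℝ) := by exact_mod_cast (show M ≤ M + J by omega)
      simp only [Set.mem_uIcc, not_or, not_and, not_le]
      constructor <;> intro h <;> linarith
    rw [hint]
    have hN0 : 0 ≤ (((M + J : ℕ) : ℝ)) ^ (-r + 1) := by positivity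
    have h1r : (1 : ℝ) - r = -r + 1 := by ring
    have hne : (-r + 1) ≠ 0 := by linarith
    have hflip : ((((M + J : ℕ) : ℝ)) ^ (-r + 1) - (M : ℝ) ^ (-r + 1)) / (-r + 1)
        = ((M : ℝ) ^ (-r + 1) - (((M + J : ℕ) : ℝ)) ^ (-r + 1)) / (r - 1) := by
      rw [div_eq_div_iff hne hr1.ne']
      ring
    rw [hflip, h1r]
    exact div_le_div_of_nonneg_right (by linarith) hr1.le

/-- **Closed-form value bound for the weighted tail.**  If `0 ≤ B(m) ≤ K m^{-s}` for all
`m ≥ M ≥ 1` with `s > n + 1`, `0 ≤ K` and `a ≤ 1`, then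
`Σ'_j C(2(M+j)+a+n, n) B(M+j) ≤ K (3+n)^n ( M^{-(s-n)} + M^{1-(s-n)}/(s-n-1) )`;
no summability hypothesis is needed. [folklore] -/
theorem tsum_choose_mul_le_of_le_rpow {n M a : ℕ} (hM : 1 ≤ M) (ha : a ≤ 1) {B : ℕ → ℝ}
    {K s : ℝ} (hs : (n : ℝ) + 1 < s) (hK : 0 ≤ K) (hB0 : ∀ j, 0 ≤ B (M + j))
    (hB : ∀ j, B (M + j) ≤ K * ((M + j : ℕ) : ℝ) ^ (-s)) :
    ∑' j, (((2 * (M + j) + a + n).choose n : ℕ) : ℝ) * B (M + j)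
      ≤ K * ((3 : ℝ) + n) ^ n *
          ((M : ℝ) ^ (-(s - n)) + (M : ℝ) ^ (1 - (s - n)) / (s - n - 1)) := by
  refine Real.tsum_le_of_sum_range_le (fun j => mul_nonneg (Nat.cast_nonneg _) (hB0 j)) (fun J => ?_)
  have hterm : ∀ j, (((2 * (M + j) + a + n).choose n : ℕ) : ℝ) * B (M + j)
      ≤ K * ((3 : ℝ) + n) ^ n * ((M + j : ℕ) : ℝ) ^ (-(s - n)) := by
    intro j
    have hm1 : (1 : ℝ) ≤ ((M + j : ℕ) : ℝ) := by exact_mod_cast (show 1 ≤ M + j by omega)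
    have hm0 : (0 : ℝ) < ((M + j : ℕ) : ℝ) := by linarith
    have hc : (((2 * (M + j) + a + n).choose n : ℕ) : ℝ) ≤ (((3 : ℝ) + n) * ((M + j : ℕ) : ℝ)) ^ n := by
      have h1 : (((2 * (M + j) + a + n).choose n : ℕ) : ℝ) ≤ (((2 * (M + j) + a + n : ℕ) : ℝ)) ^ n := by
        exact_mod_cast Nat.choose_le_pow _ _
      refine h1.trans (pow_le_pow_left₀ (by positivity) ?_ n)
      have h3 : (2 * (M + j) + a + n : ℕ) ≤ (3 + n) * (M + j) := by nlinarith
      exact_mod_cast h3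
    calc (((2 * (M + j) + a + n).choose n : ℕ) : ℝ) * B (M + j)
        ≤ (((3 : ℝ) + n) * ((M + j : ℕ) : ℝ)) ^ n * (K * ((M + j : ℕ) : ℝ) ^ (-s)) :=
          mul_le_mul hc (hB j) (hB0 j) (by positivity)
      _ = K * ((3 : ℝ) + n) ^ n * ((M + j : ℕ) : ℝ) ^ (-(s - n)) := by
          rw [mul_pow, show -(s - (n : ℝ)) = (n : ℝ) + (-s) by ring, Real.rpow_add hm0,
            Real.rpow_natCast]
          ring
  calc ∑ j ∈ range J, (((2 * (M + j) + a + n).choose n : ℕ) : ℝ) * B (M + j)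
      ≤ ∑ j ∈ range J, K * ((3 : ℝ) + n) ^ n * ((M + j : ℕ) : ℝ) ^ (-(s - n)) :=
        Finset.sum_le_sum fun j _ => hterm j
    _ = K * ((3 : ℝ) + n) ^ n * ∑ j ∈ range J, ((M + j : ℕ) : ℝ) ^ (-(s - n)) := by
        rw [Finset.mul_sum]
    _ ≤ K * ((3 : ℝ) + n) ^ n *
          ((M : ℝ) ^ (-(s - n)) + (M : ℝ) ^ (1 - (s - n)) / (s - n - 1)) :=
        mul_le_mul_of_nonneg_left (sum_range_rpow_neg_le hM (by linarith) J) (by positivity)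

end Literature.Probability.FitznerVanDerHofstad2017
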